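import Summits.ResolutionOfSingularities.ResolutionOfSingularities.Theorems.RisoStrataRisoCentresResolveCurveLU
import Summits.ResolutionOfSingularities.ResolutionOfSingularities.Theorems.RisoStrataRisoCentresResolveHeightOne
import Summits.ResolutionOfSingularities.ResolutionOfSingularities.Theorems.RisoStrataRisoCentresResolveLazyHeightOne

/-!
# Route RisoStrata — crux `RisoCentresResolve` (stmt-ResolutionOfSingularities-18546): SKELETON of
# line `Sketch`, v10 (lead c3, 2026-08-17: composition and the two open cores UNCHANGED from v7; c2 added
# the typed characteristic-`p` structure theory; c3 added the rtd-free tower theorem and the two honest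
# refutation reductions listed at the end)

`RisoCentresResolve` (Monreal, arXiv:2606.12554, Question 1.6 in characteristic `p`, ∃-schedule
form along valuations) is EQUIVALENT to its local-uniformization form
(`Theorems/RisoStrataRisoCentresResolveReduction.lean`: `risoCentresResolve_iff_localUnif`,
sorry-free; all transfer stubs of v1–v3 are tree theorems, see `Lines/Sketch.md`).

State of the core, by transcendence degree of `K/k`:
* `Algebra.trdeg k K ≤ 1` (points and CURVES) — PROVED: `rcr_localUnif_curve`
  (`…Theorems/RisoStrataRisoCentresResolveCurveLU.lean`, p156668; stubs p155619 p155721 p155431);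
  the support item `RisoCurves` (stmt-…-18550) is closed from it (`risoCurves_proof`, p156720).
* `Algebra.trdeg k K ≤ 2`, not `≤ 1` (SURFACES) — reduced here to CLOSED-POINT centres and words
  with infinitely many top letters: `stub_rcrSurfaceClosed` (OPEN core for surfaces) asks for ONE
  word `w` with infinitely many letters `≥ N` uniformizing every valuation ring whose centre on each
  chart containing it has a local ring of dimension `≥ 2` (a closed point); every other valuation
  ring (centre of dimension `≤ 1`) is uniformized by ANY such word (`stub_rcrLazyHeightOne`,
  LANDED p158732, `…Theorems/RisoStrataRisoCentresResolveLazyHeightOne.lean`, from the landed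
  height-one tool `…HeightOne*.lean`, p157607 p157633 p157670 p157884: at a non-top letter the
  local ring either stays or undergoes the quadratic transform along `O`, at top letters with
  singular centre it transforms, and infinitely many transforms reach the regular `O`).
* `2 < Algebra.trdeg k K` — `stub_rcrLocalUnifVeryHigh` (OPEN; centres of intermediate dimension
  are not covered by the height-one tool).

Composition: `rcr_localUnif` (case splits) feeds `risoCentresResolve_of_localUnif`.

Typed characteristic-`p` structure landed by lead c2 (all `Theorems/RisoStrataRisoCentresResolve*.lean`,
sorry-free; see `Cruxes/RisoCentresResolve/CHARP-ALPHABET.md`):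
* COLLAPSE: `pcusp_not_rtd_one`, `pcusp_not_isRegularLocalRing`, `pcusp_risoCen_le` (…PCuspFamily/
  …PCuspNotRegular/…PCuspCentre) — along the purely inseparable singular line of `w^p = u y^p` typed
  `rtd = 0`, so EVERY letter's centre contains that curve: in char `p` the letter `0` is not
  zero-dimensional and schedules degenerate to the constant top word on inseparable strata.
* `T` IS TYPED-CLEAN: `toricT_vertex_not_rtd_one` (…ToricTVertexInst, from the abstract core
  …ToricTVertex) — rtd 0 at the vertex of the recurring toric fourfold `T`; with the product lemma
  `rtd_adjoin_indeterminate` (…AdjoinIndeterminate, from …ProductPad + …AdjoinArcEquiv) and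
  `ta_transcendental_X2` (…TranscX2) the curve points have rtd ≥ 1 (`toricT_curve_rtd_one`, in
  progress): the word `(0, top)` resolves `T` in the typed semantics, `T` is no counterexample.
* TOOLS: direction calculus `dir_realise`/`dir_transport` (…DirCalculus), Hahn-series order kit and
  Frobenius identity (…PCuspTools), monomial arcs of Laurent subalgebras (…ToricTVertexInst).
* CYCLE 2: the typed TANGENT-CONE LEMMA `cone_initialForm`/`cone_rtd_route` (…ConeLemma, p169475:
  initial forms of relations are `W`-invariant at every arc tangent vector — Monreal Thm 1.2/4.13 in
  the encoding) and the COLLAPSE THEOREM `risoStage_eq_of_collapse`/`rcr_collapse_route` (…Collapse,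
  p171243: if every singular maximal ideal has typed rtd 0 the tower is schedule-independent, i.e. the
  crux on such `K` is the single question whether iterated blow-up of the REDUCED singular locus
  (`top^∞`) uniformizes every valuation). Probes of `top^∞` (`Cruxes/…/SURFACE-PROBER.md`, pure-Python
  GF(q) Gröbner/radical/blow-up engine with loop certificates): every toric surface/threefold tried
  (~900) and every non-toric hypersurface decided so far (Zariski `z^p = f`, inseparable singular
  curves, wild `z^p + az + b`, Brieskorn, parametrised non-normal, cDV threefolds) is resolved by
  `top^∞`; no loop below the toric fourfold `T` is known.
Any ENGINE for `stub_rcrSurfaceClosed` must handle positive-dimensional letter-0 centres ("unnormalised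
Lipman": Lipman 1978 covers NORMALISED `Sing_red` blow-ups only); any TRAP for `stub_rcrLocalUnifVeryHigh`
must beat the absorption obstruction of CHARP-ALPHABET.md §2.4.
LEAD c3 (`Cruxes/…/REGIME-I.md`): the RTD-FREE TOWER THEOREM `rcr_isolated_tower`
(`…IsolatedStep.lean`, p173446: at a centre that is an ISOLATED singular point every letter is lazy or
the quadratic transform along `O` — `rcr_minimalPrimeStep` generalises the height-one step to "centre =
minimal prime of Cen" in any dimension) and the two kernel-checked refutation reductions
`RisoCentresResolve_false_of_IsolatedQuadraticLoop` (an immortal isolated chain = Hauser–Perlega's open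
"forced cycle"; impossible in char 0, for toric presentations and for `S₂` surface stages) and
`RisoCentresResolve_false_of_CollapsedTowerLoop` (p173784: collapse along the looping tower's own stages —
the honest form of c2's `CollapsedTopLoop`, whose global collapse clause is unsatisfiable). After c1–c3
every residual question of this crux is a classical char-`p` blow-up termination problem (forced cycles /
unnormalised Lipman / mixed traps needing two-sided typed-rtd certification off the toric sector).
-/

noncomputable section

set_option linter.dupNamespace false -- mandated namespace of this single-conjunct summit

namespace Summit.ResolutionOfSingularities.ResolutionOfSingularities.Theorems

open Summit.ResolutionOfSingularities.ResolutionOfSingularities.Theses.RisoStrata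
open Literature.AlgebraicGeometry.Resolution

section Skeleton

/-- **Stub (the OPEN core for SURFACES, at closed points).** For presentations of transcendence
degree `2`: ONE word with infinitely many top letters such that every valuation ring `O ⊇ k` whose
centre on every chart `k[hᵢ/hⱼ] ⊆ O` is a CLOSED point (local ring of dimension `≥ 2`) admits an
admissible chart path of the `w`-tower reaching a regular local ring at the centre of `O`.
(Monreal Q1.6 local form for surfaces, concentrated at infinitely near closed points; candidate
words `(0, top)^∞`, `(0, 1, top)^∞`; no termination measure known; open in characteristic zero
as well.) -/
theorem stub_rcrSurfaceClosed : ∀ p : ℕ, p.Prime → ∀ (k : Type) [Field k] [CharP k p] [IsAlgClosed k]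
    (K : Type) [Field K] [Algebra k K] (N : ℕ) (h : Fin (N + 1) → K), (∀ i, h i ≠ 0) →
    IntermediateField.adjoin k
      (Set.range fun ij : Fin (N + 1) × Fin (N + 1) => h ij.1 * (h ij.2)⁻¹) = ⊤ →
    Algebra.trdeg k K ≤ 2 → ¬ Algebra.trdeg k K ≤ 1 →
    ∃ w : ℕ → ℕ, (∀ n : ℕ, ∃ t, n ≤ t ∧ N ≤ w t) ∧ ∀ O : ValuationSubring K, (∀ c : k, algebraMap k K c ∈ O) →
      (∀ j : Fin (N + 1), (∀ i, h i * (h j)⁻¹ ∈ O) →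
        ¬ ringKrullDim ↥(risoLoc O (Algebra.adjoin k (Set.range fun i => h i * (h j)⁻¹))) ≤ 1) →
      ∃ (j : Fin (N + 1)) (x : ℕ → K) (t : ℕ), (∀ i, h i * (h j)⁻¹ ∈ O) ∧
        (∀ s, s < t → risoValid (fun (B : Subalgebra k K) (m : Ideal ↥B) (d : ℕ) => ¬ ∃ (n : ℕ) (g : Fin n → ↥B),
        (∀ i, g i ∈ m) ∧ Algebra.adjoin k (Set.range fun i => (g i : K)) = B ∧
        ∃ W : Submodule k (Fin n → k), d + 1 ≤ Module.finrank k ↥W ∧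
        ∃ φ : {α : ↥B →ₐ[k] HahnSeries ℚ k // ∀ b ∈ m, 0 < (α b).orderTop} → (Fin n → HahnSeries ℚ k),
          (∀ a b : {α : ↥B →ₐ[k] HahnSeries ℚ k // ∀ b ∈ m, 0 < (α b).orderTop}, a ≠ b →
            ∃ j, ∀ i, (a.1 (g j) - b.1 (g j)).orderTop <
              ((φ a i - φ b i) - (a.1 (g i) - b.1 (g i))).orderTop) ∧
          (∀ a i, 0 < (φ a i).orderTop) ∧
          (∀ a, ∀ w : Fin n → HahnSeries ℚ k, (∀ i, 0 < (w i).orderTop) →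
            w ∈ Submodule.span (HahnSeries ℚ k)
              ((fun u : Fin n → k => fun i => HahnSeries.C (u i)) '' (W : Set (Fin n → k))) →
              ∃ b, φ b = φ a + w)) O
          (risoStage (fun (B : Subalgebra k K) (m : Ideal ↥B) (d : ℕ) => ¬ ∃ (n : ℕ) (g : Fin n → ↥B),
        (∀ i, g i ∈ m) ∧ Algebra.adjoin k (Set.range fun i => (g i : K)) = B ∧
        ∃ W : Submodule k (Fin n → k), d + 1 ≤ Module.finrank k ↥W ∧
        ∃ φ : {α : ↥B →ₐ[k] HahnSeries ℚ k // ∀ b ∈ m, 0 < (α b).orderTop} → (Fin n → HahnSeries ℚ k),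
          (∀ a b : {α : ↥B →ₐ[k] HahnSeries ℚ k // ∀ b ∈ m, 0 < (α b).orderTop}, a ≠ b →
            ∃ j, ∀ i, (a.1 (g j) - b.1 (g j)).orderTop <
              ((φ a i - φ b i) - (a.1 (g i) - b.1 (g i))).orderTop) ∧
          (∀ a i, 0 < (φ a i).orderTop) ∧
          (∀ a, ∀ w : Fin n → HahnSeries ℚ k, (∀ i, 0 < (w i).orderTop) →
            w ∈ Submodule.span (HahnSeries ℚ k)
              ((fun u : Fin n → k => fun i => HahnSeries.C (u i)) '' (W : Set (Fin n → k))) →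
              ∃ b, φ b = φ a + w)) (Algebra.adjoin k (Set.range fun i => h i * (h j)⁻¹))
            ((List.range t).map w) x s) (w s) (x s)) ∧
        IsRegularLocalRing ↥(risoLoc O
          (risoStage (fun (B : Subalgebra k K) (m : Ideal ↥B) (d : ℕ) => ¬ ∃ (n : ℕ) (g : Fin n → ↥B),
        (∀ i, g i ∈ m) ∧ Algebra.adjoin k (Set.range fun i => (g i : K)) = B ∧
        ∃ W : Submodule k (Fin n → k), d + 1 ≤ Module.finrank k ↥W ∧
        ∃ φ : {α : ↥B →ₐ[k] HahnSeries ℚ k // ∀ b ∈ m, 0 < (α b).orderTop} → (Fin n → HahnSeries ℚ k),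
          (∀ a b : {α : ↥B →ₐ[k] HahnSeries ℚ k // ∀ b ∈ m, 0 < (α b).orderTop}, a ≠ b →
            ∃ j, ∀ i, (a.1 (g j) - b.1 (g j)).orderTop <
              ((φ a i - φ b i) - (a.1 (g i) - b.1 (g i))).orderTop) ∧
          (∀ a i, 0 < (φ a i).orderTop) ∧
          (∀ a, ∀ w : Fin n → HahnSeries ℚ k, (∀ i, 0 < (w i).orderTop) →
            w ∈ Submodule.span (HahnSeries ℚ k)
              ((fun u : Fin n → k => fun i => HahnSeries.C (u i)) '' (W : Set (Fin n → k))) →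
              ∃ b, φ b = φ a + w)) (Algebra.adjoin k (Set.range fun i => h i * (h j)⁻¹))
            ((List.range t).map w) x t)) := by
  sorry

/-- **Stub (the OPEN core in transcendence degree ≥ 3).** Monreal Q1.6 in characteristic `p`, local
form, for presentations with `2 < Algebra.trdeg k K` (the constant top word is dead from dimension
4 on, `ConstantTopWordDead.md`). -/
theorem stub_rcrLocalUnifVeryHigh : ∀ p : ℕ, p.Prime → ∀ (k : Type) [Field k] [CharP k p] [IsAlgClosed k]
    (K : Type) [Field K] [Algebra k K] (N : ℕ) (h : Fin (N + 1) → K), (∀ i, h i ≠ 0) →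
    IntermediateField.adjoin k
      (Set.range fun ij : Fin (N + 1) × Fin (N + 1) => h ij.1 * (h ij.2)⁻¹) = ⊤ →
    2 < Algebra.trdeg k K →
    ∃ w : ℕ → ℕ, ∀ O : ValuationSubring K, (∀ c : k, algebraMap k K c ∈ O) →
      ∃ (j : Fin (N + 1)) (x : ℕ → K) (t : ℕ), (∀ i, h i * (h j)⁻¹ ∈ O) ∧
        (∀ s, s < t → risoValid (fun (B : Subalgebra k K) (m : Ideal ↥B) (d : ℕ) => ¬ ∃ (n : ℕ) (g : Fin n → ↥B),
        (∀ i, g i ∈ m) ∧ Algebra.adjoin k (Set.range fun i => (g i : K)) = B ∧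
        ∃ W : Submodule k (Fin n → k), d + 1 ≤ Module.finrank k ↥W ∧
        ∃ φ : {α : ↥B →ₐ[k] HahnSeries ℚ k // ∀ b ∈ m, 0 < (α b).orderTop} → (Fin n → HahnSeries ℚ k),
          (∀ a b : {α : ↥B →ₐ[k] HahnSeries ℚ k // ∀ b ∈ m, 0 < (α b).orderTop}, a ≠ b →
            ∃ j, ∀ i, (a.1 (g j) - b.1 (g j)).orderTop <
              ((φ a i - φ b i) - (a.1 (g i) - b.1 (g i))).orderTop) ∧
          (∀ a i, 0 < (φ a i).orderTop) ∧
          (∀ a, ∀ w : Fin n → HahnSeries ℚ k, (∀ i, 0 < (w i).orderTop) →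
            w ∈ Submodule.span (HahnSeries ℚ k)
              ((fun u : Fin n → k => fun i => HahnSeries.C (u i)) '' (W : Set (Fin n → k))) →
              ∃ b, φ b = φ a + w)) O
          (risoStage (fun (B : Subalgebra k K) (m : Ideal ↥B) (d : ℕ) => ¬ ∃ (n : ℕ) (g : Fin n → ↥B),
        (∀ i, g i ∈ m) ∧ Algebra.adjoin k (Set.range fun i => (g i : K)) = B ∧
        ∃ W : Submodule k (Fin n → k), d + 1 ≤ Module.finrank k ↥W ∧
        ∃ φ : {α : ↥B →ₐ[k] HahnSeries ℚ k // ∀ b ∈ m, 0 < (α b).orderTop} → (Fin n → HahnSeries ℚ k),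
          (∀ a b : {α : ↥B →ₐ[k] HahnSeries ℚ k // ∀ b ∈ m, 0 < (α b).orderTop}, a ≠ b →
            ∃ j, ∀ i, (a.1 (g j) - b.1 (g j)).orderTop <
              ((φ a i - φ b i) - (a.1 (g i) - b.1 (g i))).orderTop) ∧
          (∀ a i, 0 < (φ a i).orderTop) ∧
          (∀ a, ∀ w : Fin n → HahnSeries ℚ k, (∀ i, 0 < (w i).orderTop) →
            w ∈ Submodule.span (HahnSeries ℚ k)
              ((fun u : Fin n → k => fun i => HahnSeries.C (u i)) '' (W : Set (Fin n → k))) →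
              ∃ b, φ b = φ a + w)) (Algebra.adjoin k (Set.range fun i => h i * (h j)⁻¹))
            ((List.range t).map w) x s) (w s) (x s)) ∧
        IsRegularLocalRing ↥(risoLoc O
          (risoStage (fun (B : Subalgebra k K) (m : Ideal ↥B) (d : ℕ) => ¬ ∃ (n : ℕ) (g : Fin n → ↥B),
        (∀ i, g i ∈ m) ∧ Algebra.adjoin k (Set.range fun i => (g i : K)) = B ∧
        ∃ W : Submodule k (Fin n → k), d + 1 ≤ Module.finrank k ↥W ∧
        ∃ φ : {α : ↥B →ₐ[k] HahnSeries ℚ k // ∀ b ∈ m, 0 < (α b).orderTop} → (Fin n → HahnSeries ℚ k),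
          (∀ a b : {α : ↥B →ₐ[k] HahnSeries ℚ k // ∀ b ∈ m, 0 < (α b).orderTop}, a ≠ b →
            ∃ j, ∀ i, (a.1 (g j) - b.1 (g j)).orderTop <
              ((φ a i - φ b i) - (a.1 (g i) - b.1 (g i))).orderTop) ∧
          (∀ a i, 0 < (φ a i).orderTop) ∧
          (∀ a, ∀ w : Fin n → HahnSeries ℚ k, (∀ i, 0 < (w i).orderTop) →
            w ∈ Submodule.span (HahnSeries ℚ k)
              ((fun u : Fin n → k => fun i => HahnSeries.C (u i)) '' (W : Set (Fin n → k))) →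
              ∃ b, φ b = φ a + w)) (Algebra.adjoin k (Set.range fun i => h i * (h j)⁻¹))
            ((List.range t).map w) x t)) := by
  sorry

/-- **Riso local uniformization for SURFACES** from the closed-point core and the LANDED lazy
height-one theorem: the word of `stub_rcrSurfaceClosed` serves every valuation ring — closed-point
centres by that stub, centres of dimension `≤ 1` by `stub_rcrLazyHeightOne` (cut levels `≥ N` hold
at every maximal ideal by `hidden_cut_of_le`). -/
theorem rcr_localUnif_surface : ∀ p : ℕ, p.Prime → ∀ (k : Type) [Field k] [CharP k p] [IsAlgClosed k]
    (K : Type) [Field K] [Algebra k K] (N : ℕ) (h : Fin (N + 1) → K), (∀ i, h i ≠ 0) →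
    IntermediateField.adjoin k
      (Set.range fun ij : Fin (N + 1) × Fin (N + 1) => h ij.1 * (h ij.2)⁻¹) = ⊤ →
    Algebra.trdeg k K ≤ 2 → ¬ Algebra.trdeg k K ≤ 1 →
    ∃ w : ℕ → ℕ, ∀ O : ValuationSubring K, (∀ c : k, algebraMap k K c ∈ O) →
      ∃ (j : Fin (N + 1)) (x : ℕ → K) (t : ℕ), (∀ i, h i * (h j)⁻¹ ∈ O) ∧
        (∀ s, s < t → risoValid (fun (B : Subalgebra k K) (m : Ideal ↥B) (d : ℕ) => ¬ ∃ (n : ℕ) (g : Fin n → ↥B),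
        (∀ i, g i ∈ m) ∧ Algebra.adjoin k (Set.range fun i => (g i : K)) = B ∧
        ∃ W : Submodule k (Fin n → k), d + 1 ≤ Module.finrank k ↥W ∧
        ∃ φ : {α : ↥B →ₐ[k] HahnSeries ℚ k // ∀ b ∈ m, 0 < (α b).orderTop} → (Fin n → HahnSeries ℚ k),
          (∀ a b : {α : ↥B →ₐ[k] HahnSeries ℚ k // ∀ b ∈ m, 0 < (α b).orderTop}, a ≠ b →
            ∃ j, ∀ i, (a.1 (g j) - b.1 (g j)).orderTop <
              ((φ a i - φ b i) - (a.1 (g i) - b.1 (g i))).orderTop) ∧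
          (∀ a i, 0 < (φ a i).orderTop) ∧
          (∀ a, ∀ w : Fin n → HahnSeries ℚ k, (∀ i, 0 < (w i).orderTop) →
            w ∈ Submodule.span (HahnSeries ℚ k)
              ((fun u : Fin n → k => fun i => HahnSeries.C (u i)) '' (W : Set (Fin n → k))) →
              ∃ b, φ b = φ a + w)) O
          (risoStage (fun (B : Subalgebra k K) (m : Ideal ↥B) (d : ℕ) => ¬ ∃ (n : ℕ) (g : Fin n → ↥B),
        (∀ i, g i ∈ m) ∧ Algebra.adjoin k (Set.range fun i => (g i : K)) = B ∧
        ∃ W : Submodule k (Fin n → k), d + 1 ≤ Module.finrank k ↥W ∧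
        ∃ φ : {α : ↥B →ₐ[k] HahnSeries ℚ k // ∀ b ∈ m, 0 < (α b).orderTop} → (Fin n → HahnSeries ℚ k),
          (∀ a b : {α : ↥B →ₐ[k] HahnSeries ℚ k // ∀ b ∈ m, 0 < (α b).orderTop}, a ≠ b →
            ∃ j, ∀ i, (a.1 (g j) - b.1 (g j)).orderTop <
              ((φ a i - φ b i) - (a.1 (g i) - b.1 (g i))).orderTop) ∧
          (∀ a i, 0 < (φ a i).orderTop) ∧
          (∀ a, ∀ w : Fin n → HahnSeries ℚ k, (∀ i, 0 < (w i).orderTop) →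
            w ∈ Submodule.span (HahnSeries ℚ k)
              ((fun u : Fin n → k => fun i => HahnSeries.C (u i)) '' (W : Set (Fin n → k))) →
              ∃ b, φ b = φ a + w)) (Algebra.adjoin k (Set.range fun i => h i * (h j)⁻¹))
            ((List.range t).map w) x s) (w s) (x s)) ∧
        IsRegularLocalRing ↥(risoLoc O
          (risoStage (fun (B : Subalgebra k K) (m : Ideal ↥B) (d : ℕ) => ¬ ∃ (n : ℕ) (g : Fin n → ↥B),
        (∀ i, g i ∈ m) ∧ Algebra.adjoin k (Set.range fun i => (g i : K)) = B ∧
        ∃ W : Submodule k (Fin n → k), d + 1 ≤ Module.finrank k ↥W ∧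
        ∃ φ : {α : ↥B →ₐ[k] HahnSeries ℚ k // ∀ b ∈ m, 0 < (α b).orderTop} → (Fin n → HahnSeries ℚ k),
          (∀ a b : {α : ↥B →ₐ[k] HahnSeries ℚ k // ∀ b ∈ m, 0 < (α b).orderTop}, a ≠ b →
            ∃ j, ∀ i, (a.1 (g j) - b.1 (g j)).orderTop <
              ((φ a i - φ b i) - (a.1 (g i) - b.1 (g i))).orderTop) ∧
          (∀ a i, 0 < (φ a i).orderTop) ∧
          (∀ a, ∀ w : Fin n → HahnSeries ℚ k, (∀ i, 0 < (w i).orderTop) →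
            w ∈ Submodule.span (HahnSeries ℚ k)
              ((fun u : Fin n → k => fun i => HahnSeries.C (u i)) '' (W : Set (Fin n → k))) →
              ∃ b, φ b = φ a + w)) (Algebra.adjoin k (Set.range fun i => h i * (h j)⁻¹))
            ((List.range t).map w) x t)) := by
  intro p hp k _ _ _ K _ _ N h hh hgen h2 h1
  obtain ⟨w, hwtop, hclosed⟩ := stub_rcrSurfaceClosed p hp k K N h hh hgen h2 h1
  refine ⟨w, fun O hk => ?_⟩
  by_cases hO1 : ∃ j : Fin (N + 1), (∀ i, h i * (h j)⁻¹ ∈ O) ∧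
      ringKrullDim ↥(risoLoc O (Algebra.adjoin k (Set.range fun i => h i * (h j)⁻¹))) ≤ 1
  · obtain ⟨j₀, hj₀, hdim⟩ := hO1
    exact stub_rcrLazyHeightOne _ N (fun B m hm d hd => hidden_cut_of_le N h hh hgen B m hm hd)
      w hwtop h hh hgen O hk j₀ hj₀ hdim
  · exact hclosed O hk fun j hj hle => hO1 ⟨j, hj, hle⟩

/-- **Riso local uniformization in transcendence degree ≥ 2** (the v4/v5 stub
`stub_rcrLocalUnifHigher`, now glue): surfaces by `rcr_localUnif_surface`, higher by
`stub_rcrLocalUnifVeryHigh`. -/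
theorem rcr_localUnif_higher : ∀ p : ℕ, p.Prime → ∀ (k : Type) [Field k] [CharP k p] [IsAlgClosed k]
    (K : Type) [Field K] [Algebra k K] (N : ℕ) (h : Fin (N + 1) → K), (∀ i, h i ≠ 0) →
    IntermediateField.adjoin k
      (Set.range fun ij : Fin (N + 1) × Fin (N + 1) => h ij.1 * (h ij.2)⁻¹) = ⊤ →
    1 < Algebra.trdeg k K →
    ∃ w : ℕ → ℕ, ∀ O : ValuationSubring K, (∀ c : k, algebraMap k K c ∈ O) →
      ∃ (j : Fin (N + 1)) (x : ℕ → K) (t : ℕ), (∀ i, h i * (h j)⁻¹ ∈ O) ∧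
        (∀ s, s < t → risoValid (fun (B : Subalgebra k K) (m : Ideal ↥B) (d : ℕ) => ¬ ∃ (n : ℕ) (g : Fin n → ↥B),
        (∀ i, g i ∈ m) ∧ Algebra.adjoin k (Set.range fun i => (g i : K)) = B ∧
        ∃ W : Submodule k (Fin n → k), d + 1 ≤ Module.finrank k ↥W ∧
        ∃ φ : {α : ↥B →ₐ[k] HahnSeries ℚ k // ∀ b ∈ m, 0 < (α b).orderTop} → (Fin n → HahnSeries ℚ k),
          (∀ a b : {α : ↥B →ₐ[k] HahnSeries ℚ k // ∀ b ∈ m, 0 < (α b).orderTop}, a ≠ b →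
            ∃ j, ∀ i, (a.1 (g j) - b.1 (g j)).orderTop <
              ((φ a i - φ b i) - (a.1 (g i) - b.1 (g i))).orderTop) ∧
          (∀ a i, 0 < (φ a i).orderTop) ∧
          (∀ a, ∀ w : Fin n → HahnSeries ℚ k, (∀ i, 0 < (w i).orderTop) →
            w ∈ Submodule.span (HahnSeries ℚ k)
              ((fun u : Fin n → k => fun i => HahnSeries.C (u i)) '' (W : Set (Fin n → k))) →
              ∃ b, φ b = φ a + w)) O
          (risoStage (fun (B : Subalgebra k K) (m : Ideal ↥B) (d : ℕ) => ¬ ∃ (n : ℕ) (g : Fin n → ↥B),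
        (∀ i, g i ∈ m) ∧ Algebra.adjoin k (Set.range fun i => (g i : K)) = B ∧
        ∃ W : Submodule k (Fin n → k), d + 1 ≤ Module.finrank k ↥W ∧
        ∃ φ : {α : ↥B →ₐ[k] HahnSeries ℚ k // ∀ b ∈ m, 0 < (α b).orderTop} → (Fin n → HahnSeries ℚ k),
          (∀ a b : {α : ↥B →ₐ[k] HahnSeries ℚ k // ∀ b ∈ m, 0 < (α b).orderTop}, a ≠ b →
            ∃ j, ∀ i, (a.1 (g j) - b.1 (g j)).orderTop <
              ((φ a i - φ b i) - (a.1 (g i) - b.1 (g i))).orderTop) ∧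
          (∀ a i, 0 < (φ a i).orderTop) ∧
          (∀ a, ∀ w : Fin n → HahnSeries ℚ k, (∀ i, 0 < (w i).orderTop) →
            w ∈ Submodule.span (HahnSeries ℚ k)
              ((fun u : Fin n → k => fun i => HahnSeries.C (u i)) '' (W : Set (Fin n → k))) →
              ∃ b, φ b = φ a + w)) (Algebra.adjoin k (Set.range fun i => h i * (h j)⁻¹))
            ((List.range t).map w) x s) (w s) (x s)) ∧
        IsRegularLocalRing ↥(risoLoc O
          (risoStage (fun (B : Subalgebra k K) (m : Ideal ↥B) (d : ℕ) => ¬ ∃ (n : ℕ) (g : Fin n → ↥B),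
        (∀ i, g i ∈ m) ∧ Algebra.adjoin k (Set.range fun i => (g i : K)) = B ∧
        ∃ W : Submodule k (Fin n → k), d + 1 ≤ Module.finrank k ↥W ∧
        ∃ φ : {α : ↥B →ₐ[k] HahnSeries ℚ k // ∀ b ∈ m, 0 < (α b).orderTop} → (Fin n → HahnSeries ℚ k),
          (∀ a b : {α : ↥B →ₐ[k] HahnSeries ℚ k // ∀ b ∈ m, 0 < (α b).orderTop}, a ≠ b →
            ∃ j, ∀ i, (a.1 (g j) - b.1 (g j)).orderTop <
              ((φ a i - φ b i) - (a.1 (g i) - b.1 (g i))).orderTop) ∧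
          (∀ a i, 0 < (φ a i).orderTop) ∧
          (∀ a, ∀ w : Fin n → HahnSeries ℚ k, (∀ i, 0 < (w i).orderTop) →
            w ∈ Submodule.span (HahnSeries ℚ k)
              ((fun u : Fin n → k => fun i => HahnSeries.C (u i)) '' (W : Set (Fin n → k))) →
              ∃ b, φ b = φ a + w)) (Algebra.adjoin k (Set.range fun i => h i * (h j)⁻¹))
            ((List.range t).map w) x t)) := by
  intro p hp k _ _ _ K _ _ N h hh hgen hgt
  by_cases h2 : Algebra.trdeg k K ≤ 2
  · exact rcr_localUnif_surface p hp k K N h hh hgen h2 (not_le.mpr hgt)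
  · exact stub_rcrLocalUnifVeryHigh p hp k K N h hh hgen (not_le.mp h2)

/-- **Riso local uniformization along some word** (the v3 stub `stub_rcrLocalUnif`, glue): case
split on the transcendence degree. -/
theorem rcr_localUnif : ∀ p : ℕ, p.Prime → ∀ (k : Type) [Field k] [CharP k p] [IsAlgClosed k]
    (K : Type) [Field K] [Algebra k K] (N : ℕ) (h : Fin (N + 1) → K), (∀ i, h i ≠ 0) →
    IntermediateField.adjoin k
      (Set.range fun ij : Fin (N + 1) × Fin (N + 1) => h ij.1 * (h ij.2)⁻¹) = ⊤ →
    ∃ w : ℕ → ℕ, ∀ O : ValuationSubring K, (∀ c : k, algebraMap k K c ∈ O) →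
      ∃ (j : Fin (N + 1)) (x : ℕ → K) (t : ℕ), (∀ i, h i * (h j)⁻¹ ∈ O) ∧
        (∀ s, s < t → risoValid (fun (B : Subalgebra k K) (m : Ideal ↥B) (d : ℕ) => ¬ ∃ (n : ℕ) (g : Fin n → ↥B),
        (∀ i, g i ∈ m) ∧ Algebra.adjoin k (Set.range fun i => (g i : K)) = B ∧
        ∃ W : Submodule k (Fin n → k), d + 1 ≤ Module.finrank k ↥W ∧
        ∃ φ : {α : ↥B →ₐ[k] HahnSeries ℚ k // ∀ b ∈ m, 0 < (α b).orderTop} → (Fin n → HahnSeries ℚ k),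
          (∀ a b : {α : ↥B →ₐ[k] HahnSeries ℚ k // ∀ b ∈ m, 0 < (α b).orderTop}, a ≠ b →
            ∃ j, ∀ i, (a.1 (g j) - b.1 (g j)).orderTop <
              ((φ a i - φ b i) - (a.1 (g i) - b.1 (g i))).orderTop) ∧
          (∀ a i, 0 < (φ a i).orderTop) ∧
          (∀ a, ∀ w : Fin n → HahnSeries ℚ k, (∀ i, 0 < (w i).orderTop) →
            w ∈ Submodule.span (HahnSeries ℚ k)
              ((fun u : Fin n → k => fun i => HahnSeries.C (u i)) '' (W : Set (Fin n → k))) →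
              ∃ b, φ b = φ a + w)) O
          (risoStage (fun (B : Subalgebra k K) (m : Ideal ↥B) (d : ℕ) => ¬ ∃ (n : ℕ) (g : Fin n → ↥B),
        (∀ i, g i ∈ m) ∧ Algebra.adjoin k (Set.range fun i => (g i : K)) = B ∧
        ∃ W : Submodule k (Fin n → k), d + 1 ≤ Module.finrank k ↥W ∧
        ∃ φ : {α : ↥B →ₐ[k] HahnSeries ℚ k // ∀ b ∈ m, 0 < (α b).orderTop} → (Fin n → HahnSeries ℚ k),
          (∀ a b : {α : ↥B →ₐ[k] HahnSeries ℚ k // ∀ b ∈ m, 0 < (α b).orderTop}, a ≠ b →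
            ∃ j, ∀ i, (a.1 (g j) - b.1 (g j)).orderTop <
              ((φ a i - φ b i) - (a.1 (g i) - b.1 (g i))).orderTop) ∧
          (∀ a i, 0 < (φ a i).orderTop) ∧
          (∀ a, ∀ w : Fin n → HahnSeries ℚ k, (∀ i, 0 < (w i).orderTop) →
            w ∈ Submodule.span (HahnSeries ℚ k)
              ((fun u : Fin n → k => fun i => HahnSeries.C (u i)) '' (W : Set (Fin n → k))) →
              ∃ b, φ b = φ a + w)) (Algebra.adjoin k (Set.range fun i => h i * (h j)⁻¹))
            ((List.range t).map w) x s) (w s) (x s)) ∧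
        IsRegularLocalRing ↥(risoLoc O
          (risoStage (fun (B : Subalgebra k K) (m : Ideal ↥B) (d : ℕ) => ¬ ∃ (n : ℕ) (g : Fin n → ↥B),
        (∀ i, g i ∈ m) ∧ Algebra.adjoin k (Set.range fun i => (g i : K)) = B ∧
        ∃ W : Submodule k (Fin n → k), d + 1 ≤ Module.finrank k ↥W ∧
        ∃ φ : {α : ↥B →ₐ[k] HahnSeries ℚ k // ∀ b ∈ m, 0 < (α b).orderTop} → (Fin n → HahnSeries ℚ k),
          (∀ a b : {α : ↥B →ₐ[k] HahnSeries ℚ k // ∀ b ∈ m, 0 < (α b).orderTop}, a ≠ b →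
            ∃ j, ∀ i, (a.1 (g j) - b.1 (g j)).orderTop <
              ((φ a i - φ b i) - (a.1 (g i) - b.1 (g i))).orderTop) ∧
          (∀ a i, 0 < (φ a i).orderTop) ∧
          (∀ a, ∀ w : Fin n → HahnSeries ℚ k, (∀ i, 0 < (w i).orderTop) →
            w ∈ Submodule.span (HahnSeries ℚ k)
              ((fun u : Fin n → k => fun i => HahnSeries.C (u i)) '' (W : Set (Fin n → k))) →
              ∃ b, φ b = φ a + w)) (Algebra.adjoin k (Set.range fun i => h i * (h j)⁻¹))
            ((List.range t).map w) x t)) := by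
  intro p hp k _ _ _ K _ _ N h hh hgen
  by_cases hle : Algebra.trdeg k K ≤ 1
  · exact rcr_localUnif_curve p hp k K N h hh hgen hle
  · exact rcr_localUnif_higher p hp k K N h hh hgen (not_le.mp hle)

/-- **Composition of line `Sketch`** (v7): the crux `RisoCentresResolve` from its stubs, by the
landed equivalence `risoCentresResolve_iff_localUnif`. -/
theorem RisoCentresResolve_of : RisoCentresResolve :=
  risoCentresResolve_of_localUnif rcr_localUnif

end Skeleton

end Summit.ResolutionOfSingularities.ResolutionOfSingularities.Theorems

end
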